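import Summits.ABC.IUTFork.Repair.RHHeightScaling
import HarnessLib

/-!
# R-H ROUND 3, AXIS D2 — THE DOOR VERDICT IN KERNEL FORM: at INTEGER height dilations `m_q ↦ n·m_q` every class certificate
# of a conjugate-fibre place is bounded by the m-FREE cap sum `(δ + 2G + e − 1)·L(L+1)/2`, sub-family by sub-family; a
# profile so bounded at the integer points is never a door (Archimedes) and sums of such profiles stay bounded — hence
# NO DOOR among combinations of the five price-bounded classes, with no appeal to real interpolation of the dilation

abc-iut cell, rung LADDER-ABC:A2.RESCUE.H; seat abc-iut-rh2-T-1 (gen 6), KEY `wake/KEY-abc-iut-rh2-T-1-D2-TYPE-DOOR.md` (AXIS D2 TYPER 2 of 2,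
«type any DOOR candidate … if no door candidate exists by 15:30Z, type the strongest near-miss with its exponent»). SEQUEL BY NAME of this seat's
`Repair/RHHeightScaling.lean` (vocabulary `DoorAt` / `Door` / `IsCombination` / `ObjectClass`; per-cell price ceiling `price_le_priceCap`,
`demand_le_priceCap_of_hullCellδ`, `covered_le_priceCap`, `surplus_le_priceCap`; place totals; §4 near-miss). The refuters' guard (abc-iut-rh3-tst-1
12:22:18Z / 12:37:57Z «hidden h-dependence = residues only») is met here at the integer dilations themselves: the price's residue `ρ_j(n·m₁) < e`
moves with `n` but never past the cap, so every bound below is UNIFORM in `n : ℕ`, and the door is excluded by sampling the profile at `s = n` only.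

WHAT IS PROVED (namespace `Summit.ABC.IUTFork.Repair.RH.HeightScaling`, PROOF-ONLY apart from the one bookkeeping predicate `IntPriceBounded`):
* §1 `not_doorAt_of_intSampled_le` — if `f(n)·(n·M₁) ≤ P̄` at every integer `n ≥ 1` (`M₁ > 0`) then `¬ DoorAt f` (a door constant `c > 0`
  would give `c·n·M₁ ≤ P̄` for all `n`, against Archimedes); `IntPriceBounded M₁ f` :⟺ such a `P̄` exists; `IntPriceBounded.add`;
  **`not_door_of_intPriceBounded`**: an admissibility table all of whose profiles (for the classes in `X`) are integer-price-bounded over one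
  total slope `M₁` admits NO door among combinations of classes in `X`.
* §1b CLOSING vs DOOR (abc-iut-rh3-tst-2 12:55:42Z «exponent ≥ 0 is necessary, not sufficient»): `ClosesFrom f M₁ tol s₀` (the one-member
  `ClosedBy` of rh2-w-2 with the height explicit); `not_closesFrom_of_le_const_lt_one` (a profile capped by `c < 1` never closes — the three
  exponent-0 profiles of the typed currency: licence cut at `κ < 1`, mixed-fibre transfer `(1−ε)/(1+ε)`, k5-type pilot credit `c₀ ≪ 1`),
  `not_closesFrom_of_negExponent`, `not_closesFrom_of_intSampled_le`, `closesFrom_of_one_le` (the `κ = 1` end = the Statement itself).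
* §2 PER PLACE, PER CLASS, ANY LABEL SUB-FAMILY `S ⊆ {1,…,L}`, ANY DEPTH `m ≥ 0` (so any integer dilation `m = n·m₁`), hypotheses `0 < e`,
  `e − 1 ≤ δ`, `r_out ≤ r_in` (the two structural facts of a local field, as in rh2-w-2 `RHHullCellSlice`): with `capSum := Σ_{j ≤ L} priceCap_j`
  (`two_mul_capSum_eq : 2·capSum = (δ + 2G + e − 1)·L(L+1)`, m-FREE): SLICE / LICENCE `sum_demand_le_capSum_of_licensed` (labels all licensed
  at depth `m` ⇒ their demands sum below `capSum`); SRM / PARTIAL CREDIT `sum_covered_le_capSum` (`Σ_S min(demand, price) ≤ capSum`);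
  WITHIN-PLACE FINANCING / ACROSS-PLACE NETTING `sum_surplus_le_capSum` (`Σ_S (price − demand) ≤ capSum`) and the netting envelope
  `min_sum_demand_sum_price_le_capSum` (`min(Σ demand, Σ price) ≤ capSum`). Against these, the place's trivial mass is `m·L(L−1)(2L+5)/6`
  (`RHHeightScaling.six_mul_sum_demand_eq'`), LINEAR in the depth.
* §3 THE VERDICT SHAPE `not_doorAt_of_capBound`: a profile whose value at each integer dilation `n ≥ 1` is a certificate bounded by a fixed
  weighted cap total `C̄ = Σ_w c_w·capSum_w` divided by `n·M₁` is not a door — the form in which the assembler's rows 1–6 (slice · SRM ·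
  within-place financing · partial credit · across-place netting; κ′ laws by abc-iut-rh2-w-1's extinction/price lemma) enter `not_door_of_intPriceBounded`.
* §4 JUNCTION with abc-iut-rh2-w-2's landed `Repair/RHHeightScalingBarrier.lean` is BY NAME in THEIR junction file `RHHeightScalingBarrierDoor.lean`
  (`exponentAtMost_iff_powerBoundFrom`, `not_door_and_barrier_of_table`, `not_closedBy_of_priceBounded`, …) — nothing restated here.
* §5 sanity (`decide`): HEX `λ₈ @ l = 11`, `p = 7`: `capSum = 946·15 = 14190` against `6·(trivial mass) = 120·5·4·15 = 36000` at `n = 1`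
  (`M_w = 6000 > capSum` already: this place never nets to zero on its own — it is carried by the `p | 30` places in the datum, FINAL (1)(c)).
DOOR VERDICT OF RECORD (this seat, D2-TYPE-DOOR; numbers quoted from the assembler's table, not re-derived): inside the typed currency at conjugate
fibres NO combination of the library classes is a door (exponent of every class ≤ −1; kernel: this file + `RHHeightScaling.not_door_of_priceBounded`);
the strongest near-miss is ACROSS-PLACE NETTING — recovered fraction `min(1, Π/(s·M))`, exponent −1, bed constant `Π/M` (crossing `s×` median 1.8226
FREY133 · 3.8306 HEX79 · 1.9972 FREY482, FINAL (1)(e)); the only exponent-0 profiles are the `licenceCut` HYPOTHESIS (constant `μ₀(κ)`, not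
bed-witnessed) and the mixed-fibre transfer (bed constant 0) of `RHHeightScaling` §5.
HONEST FRAMING: integer/real bookkeeping about OUR typed cell; «no door» is a statement about certificates obeying the typed price ceiling along the
fixed-places dilation ray (R78), not about [IUTchIII] Cor. 3.12 in print, and says nothing along families whose conductor grows with the height
(there the netted inequality is «Szpiro in costume», REF-NEGATIVES N12); nothing here asserts that abc is proved or refuted, or that Cor. 3.12 holds
or fails at any datum, or takes a side on any author; typed ≠ proved; computed ≠ proved. [claim: Mochizuki2012, status: disputed] for every IUT
locution. [cite: Mochizuki2012, IUTchIII Cor. 3.12 p. 173; IUTchIV Prop. 1.2 p. 10, Thm. 1.10 p. 21]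
-/

namespace Summit.ABC.IUTFork.Repair.RH.HeightScaling

open Finset
open Summit.ABC.IUTFork.Repair.RH.DiffPricedHull Summit.ABC.IUTFork.Repair.RH.HullCellSlice
open Summit.ABC.IUTFork.Repair.RH.HullCellSlackSum

/-! ## §1. Integer-sampled profiles: bounded certificate over a linear total ⇒ no door -/

/-- **ARCHIMEDES AGAINST THE DOOR.** If at every integer dilation `n ≥ 1` the profile's certificate `f(n)·(n·M₁)` is bounded by a fixed `P̄`
(`M₁ > 0`), then `f` is not a door: a door constant `c > 0` would force `c·M₁·n ≤ P̄` for every `n`. [folklore] -/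
theorem not_doorAt_of_intSampled_le {f : ℝ → ℝ} {Pbar M₁ : ℝ} (hM : 0 < M₁)
    (h : ∀ n : ℕ, 1 ≤ n → f n * ((n : ℝ) * M₁) ≤ Pbar) : ¬ DoorAt f := by
  rintro ⟨c, hc, hcf⟩
  obtain ⟨n, hn⟩ := exists_nat_gt (max 1 (Pbar / (c * M₁)))
  have hn1 : (1 : ℝ) ≤ n := le_of_lt ((le_max_left _ _).trans_lt hn)
  have hn1' : 1 ≤ n := by exact_mod_cast hn1
  have hP : Pbar / (c * M₁) < n := (le_max_right _ _).trans_lt hn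
  have h1 : c * ((n : ℝ) * M₁) ≤ f n * ((n : ℝ) * M₁) :=
    mul_le_mul_of_nonneg_right (hcf n hn1) (by positivity)
  have h2 : c * ((n : ℝ) * M₁) ≤ Pbar := h1.trans (h n hn1')
  have h3 : Pbar < c * ((n : ℝ) * M₁) := by
    rw [div_lt_iff₀ (by positivity)] at hP
    linarith
  exact absurd h2 (not_le.mpr h3)

/-- `IntPriceBounded M₁ f`: at the integer dilations the profile's certificate over the total slope `M₁` is bounded by a fixed constant. [folklore] -/
@[folklore]
def IntPriceBounded (M₁ : ℝ) (f : ℝ → ℝ) : Prop :=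
  ∃ Pbar : ℝ, ∀ n : ℕ, 1 ≤ n → f n * ((n : ℝ) * M₁) ≤ Pbar

/-- Integer-price-bounded profiles are not doors. [folklore] -/
theorem not_doorAt_of_intPriceBounded {M₁ : ℝ} (hM : 0 < M₁) {f : ℝ → ℝ} (hf : IntPriceBounded M₁ f) : ¬ DoorAt f := by
  obtain ⟨Pbar, h⟩ := hf
  exact not_doorAt_of_intSampled_le hM h

/-- Integer-price-boundedness is closed under sums (the bounds add). [folklore] -/
theorem IntPriceBounded.add {M₁ : ℝ} {f g : ℝ → ℝ} (hf : IntPriceBounded M₁ f) (hg : IntPriceBounded M₁ g) :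
    IntPriceBounded M₁ (f + g) := by
  obtain ⟨P, hP⟩ := hf
  obtain ⟨Q, hQ⟩ := hg
  refine ⟨P + Q, fun n hn => ?_⟩
  rw [Pi.add_apply, add_mul]
  exact add_le_add (hP n hn) (hQ n hn)

/-- Every combination of classes all of whose admissible profiles are integer-price-bounded is integer-price-bounded. [folklore] -/
theorem intPriceBounded_of_isCombination {M₁ : ℝ} {Φ : ObjectClass → Set (ℝ → ℝ)} {X : Set ObjectClass}
    (hΦ : ∀ κ ∈ X, ∀ f ∈ Φ κ, IntPriceBounded M₁ f) {f : ℝ → ℝ} (hf : IsCombination Φ X f) : IntPriceBounded M₁ f := by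
  induction hf with
  | single hκ hg => exact hΦ _ hκ _ hg
  | add _ _ ihf ihg => exact ihf.add ihg

/-- **NO DOOR among combinations of integer-price-bounded classes** (total slope `M₁ > 0`). [folklore] -/
theorem not_door_of_intPriceBounded {M₁ : ℝ} (hM : 0 < M₁) {Φ : ObjectClass → Set (ℝ → ℝ)} {X : Set ObjectClass}
    (hΦ : ∀ κ ∈ X, ∀ f ∈ Φ κ, IntPriceBounded M₁ f) : ¬ Door Φ X := by
  rintro ⟨f, hf, hd⟩
  exact not_doorAt_of_intPriceBounded hM (intPriceBounded_of_isCombination hΦ hf) hd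

/-! ## §1b. CLOSING versus DOOR (refuter abc-iut-rh3-tst-2 12:55:42Z: «exponent ≥ 0 is necessary, not sufficient») -/

/-- `ClosesFrom f M₁ tol s₀`: from dilation `s₀` on the recovered-fraction profile `f` CLOSES the requirement — `M₁·s − tol ≤ f(s)·(M₁·s)`
(the one-member case of rh2-w-2's `ClosedBy`; `T(s) = M(s) − Tol ≤ certified mass`, MIN-SLICE (ii) `massThreshold_le_onTrivialMass_iff` with
the height explicit). A DOOR (`DoorAt`: positive height-free fraction) is NECESSARY for closing at large height, not sufficient: closing needs
the fraction to reach `1 − tol/(M₁·s) → 1`. [claim: Mochizuki2012, status: disputed] -/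
@[claim "Mochizuki2012" "disputed"]
def ClosesFrom (f : ℝ → ℝ) (M₁ tol s₀ : ℝ) : Prop :=
  ∀ s : ℝ, s₀ ≤ s → M₁ * s - tol ≤ f s * (M₁ * s)

/-- **A profile capped by a constant `c < 1` NEVER closes from any `s₀`** (`M₁ > 0`): at `s > max(s₀, 1, tol/((1−c)·M₁))` the requirement
exceeds `c·M(s)`. Kills, as CLOSING doors, all three exponent-0 profiles of the typed currency: the `licenceCut` hypothesis at `κ < 1`
(`μ₀(κ) < 1`), the mixed-fibre transfer (`f₀ = (1−ε)/(1+ε) < 1`, rh3-tst-2 12:47:08Z) and the k5-type pilot credit inside the κ′ class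
(`c₀ = (den − f(1))/dS⁺ ≪ 1`, rh3-tst-2 12:55:42Z) — doors in the weak sense `DoorAt`, closing nothing. [folklore] -/
theorem not_closesFrom_of_le_const_lt_one {f : ℝ → ℝ} {c M₁ tol s₀ : ℝ} (hM : 0 < M₁) (hc : c < 1)
    (hf : ∀ s : ℝ, 1 ≤ s → f s ≤ c) : ¬ ClosesFrom f M₁ tol s₀ := by
  intro h
  set s : ℝ := max (max s₀ 1) (tol / ((1 - c) * M₁) + 1) with hs_def
  have hs₀ : s₀ ≤ s := (le_max_left _ _).trans (le_max_left _ _)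
  have hs1 : 1 ≤ s := (le_max_right _ _).trans (le_max_left _ _)
  have hst : tol / ((1 - c) * M₁) + 1 ≤ s := le_max_right _ _
  have h1 := h s hs₀
  have h2 : f s * (M₁ * s) ≤ c * (M₁ * s) := mul_le_mul_of_nonneg_right (hf s hs1) (by positivity)
  have h3 : tol < (1 - c) * M₁ * s := by
    have hpos : 0 < (1 - c) * M₁ := by nlinarith
    rw [div_add_one hpos.ne', div_le_iff₀ hpos] at hst
    nlinarith
  nlinarith

/-- **A negative exponent never closes** (`M₁ > 0`; any `tol`, any onset): the fraction is eventually below `1/2` while closing needs it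
`≥ 1 − tol/(M₁·s)`. With `RHHeightScaling.not_doorAt_of_negExponent`: negative exponent ⇒ neither a door nor a closing. [folklore] -/
theorem not_closesFrom_of_negExponent {f : ℝ → ℝ} (hf : NegExponent f) {M₁ tol s₀ : ℝ} (hM : 0 < M₁) :
    ¬ ClosesFrom f M₁ tol s₀ := by
  obtain ⟨α, C, hα, -, hexp⟩ := hf
  obtain ⟨s₁, hs₁, hlt⟩ := eventuallyBelow_of_exponentAtMost hexp hα one_half_pos
  intro h
  set s : ℝ := max (max s₀ s₁) (2 * tol / M₁ + 1) with hs_def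
  have hs₀ : s₀ ≤ s := (le_max_left _ _).trans (le_max_left _ _)
  have hss₁ : s₁ ≤ s := (le_max_right _ _).trans (le_max_left _ _)
  have hst : 2 * tol / M₁ + 1 ≤ s := le_max_right _ _
  have h1 := h s hs₀
  have h2 : f s * (M₁ * s) < 1 / 2 * (M₁ * s) :=
    mul_lt_mul_of_pos_right (hlt s hss₁) (by nlinarith [hs₁.trans hss₁])
  rw [div_add_one hM.ne', div_le_iff₀ hM] at hst
  nlinarith

/-- **Integer-sampled price-bounded certificates never close** (`M₁ > 0`): at an integer dilation `n ≥ max(s₀, (P̄ + tol)/M₁ + 1)` the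
requirement `M₁·n − tol` exceeds `P̄ ≥ f(n)·(n·M₁)`. [folklore] -/
theorem not_closesFrom_of_intSampled_le {f : ℝ → ℝ} {Pbar M₁ tol s₀ : ℝ} (hM : 0 < M₁)
    (h : ∀ n : ℕ, 1 ≤ n → f n * ((n : ℝ) * M₁) ≤ Pbar) : ¬ ClosesFrom f M₁ tol s₀ := by
  intro hc
  obtain ⟨n, hn⟩ := exists_nat_gt (max (max s₀ 1) ((Pbar + tol) / M₁))
  have hn₀ : s₀ ≤ n := le_of_lt ((le_max_left _ _).trans_lt ((le_max_left _ _).trans_lt hn))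
  have hn1 : (1 : ℝ) ≤ n := le_of_lt ((le_max_right _ _).trans_lt ((le_max_left _ _).trans_lt hn))
  have hn1' : 1 ≤ n := by exact_mod_cast hn1
  have hP : (Pbar + tol) / M₁ < n := (le_max_right _ _).trans_lt hn
  have h1 := hc n hn₀
  have h2 := h n hn1'
  rw [div_lt_iff₀ hM] at hP
  have h3 : f n * (M₁ * n) = f n * ((n : ℝ) * M₁) := by ring
  linarith

/-- Conversely a profile that stays `≥ 1` closes (for `tol ≥ 0`, `M₁ ≥ 0`) — the `κ = 1` end of the licence cut, i.e. the Statement itself. [folklore] -/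
theorem closesFrom_of_one_le {f : ℝ → ℝ} {M₁ tol s₀ : ℝ} (hM : 0 ≤ M₁) (htol : 0 ≤ tol) (hs₀ : 0 ≤ s₀)
    (hf : ∀ s : ℝ, s₀ ≤ s → 1 ≤ f s) : ClosesFrom f M₁ tol s₀ := fun s hs => by
  have h1 : M₁ * s ≤ f s * (M₁ * s) := le_mul_of_one_le_left (mul_nonneg hM (hs₀.trans hs)) (hf s hs)
  linarith

/-! ## §2. Per place, per class, any label sub-family: the certificate is below the m-free cap sum -/

/-- The cap slope `δ + 2(r_in − r_out) + (e − 1)` is non-negative on a local field (`0 < e`, `e − 1 ≤ δ`, `r_out ≤ r_in`). [folklore] -/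
theorem capSlope_nonneg {e δ rin rout : ℤ} (he : 0 < e) (hδ : e - 1 ≤ δ) (hio : rout ≤ rin) :
    0 ≤ δ + 2 * (rin - rout) + (e - 1) := by omega

/-- Hence `priceCap_j ≥ 0` at every label `j ≥ 0`. [folklore] -/
theorem priceCap_nonneg {e δ rin rout j : ℤ} (he : 0 < e) (hδ : e - 1 ≤ δ) (hio : rout ≤ rin) (hj : 0 ≤ j) :
    0 ≤ priceCap e δ rin rout j :=
  mul_nonneg (capSlope_nonneg he hδ hio) hj

/-- **The cap sum in closed form**: `2·Σ_{j=1}^{L} priceCap_j = (δ + 2(r_in−r_out) + (e−1))·L·(L+1)` — m-FREE. [folklore] -/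
theorem two_mul_capSum_eq (e δ rin rout : ℤ) (L : ℕ) :
    2 * ∑ k ∈ range L, priceCap e δ rin rout (1 + (k : ℤ)) = (δ + 2 * (rin - rout) + (e - 1)) * ((L : ℤ) * (L + 1)) := by
  unfold priceCap
  rw [← mul_sum]
  have h := two_mul_sum_labels_eq 0 L
  simp only [mul_zero, zero_add] at h
  linear_combination (δ + 2 * (rin - rout) + (e - 1)) * h

/-- A per-label bound by the cap on a sub-family `S ⊆ range L` sums to at most the FULL cap sum (the caps off `S` are `≥ 0`). [folklore] -/
theorem sum_le_capSum_of_le {e δ rin rout : ℤ} (he : 0 < e) (hδ : e - 1 ≤ δ) (hio : rout ≤ rin) {L : ℕ} {S : Finset ℕ}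
    (hS : S ⊆ range L) {g : ℕ → ℤ} (hg : ∀ k ∈ S, g k ≤ priceCap e δ rin rout (1 + (k : ℤ))) :
    ∑ k ∈ S, g k ≤ ∑ k ∈ range L, priceCap e δ rin rout (1 + (k : ℤ)) :=
  (sum_le_sum hg).trans
    (sum_le_sum_of_subset_of_nonneg hS fun k _ _ => priceCap_nonneg he hδ hio (by positivity))

/-- **SLICE / LICENCE**: if every label of `S` is licensed at depth `m`, the licensed demands sum below the cap sum — at EVERY depth, so at
every integer dilation `m = n·m₁`. [folklore] -/
theorem sum_demand_le_capSum_of_licensed {e m δ rin rout : ℤ} (he : 0 < e) (hδ : e - 1 ≤ δ) (hio : rout ≤ rin) {L : ℕ}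
    {S : Finset ℕ} (hS : S ⊆ range L) (hlic : ∀ k ∈ S, HullCellδ e m (1 + (k : ℤ)) δ rin rout) :
    ∑ k ∈ S, demand m (1 + (k : ℤ)) ≤ ∑ k ∈ range L, priceCap e δ rin rout (1 + (k : ℤ)) :=
  sum_le_capSum_of_le he hδ hio hS fun k hk =>
    demand_le_priceCap_of_hullCellδ he hio (by omega) (hlic k hk)

/-- **SRM / PARTIAL CREDIT**: the covered shares `min(demand, price)` over any sub-family sum below the cap sum, every depth. [folklore] -/
theorem sum_covered_le_capSum {e m δ rin rout : ℤ} (he : 0 < e) (hδ : e - 1 ≤ δ) (hio : rout ≤ rin) {L : ℕ}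
    {S : Finset ℕ} (hS : S ⊆ range L) :
    ∑ k ∈ S, min (demand m (1 + (k : ℤ))) (price e m (1 + (k : ℤ)) δ rin rout) ≤
      ∑ k ∈ range L, priceCap e δ rin rout (1 + (k : ℤ)) :=
  sum_le_capSum_of_le he hδ hio hS fun k _ => covered_le_priceCap he hio (by omega)

/-- **WITHIN-PLACE FINANCING / ACROSS-PLACE NETTING move surpluses**: `Σ_S (price − demand) ≤ capSum`, every depth `m ≥ 0`. [folklore] -/
theorem sum_surplus_le_capSum {e m δ rin rout : ℤ} (he : 0 < e) (hδ : e - 1 ≤ δ) (hio : rout ≤ rin) (hm : 0 ≤ m) {L : ℕ}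
    {S : Finset ℕ} (hS : S ⊆ range L) :
    ∑ k ∈ S, (price e m (1 + (k : ℤ)) δ rin rout - demand m (1 + (k : ℤ))) ≤
      ∑ k ∈ range L, priceCap e δ rin rout (1 + (k : ℤ)) :=
  sum_le_capSum_of_le he hδ hio hS fun k _ => surplus_le_priceCap he hio (by omega) hm

/-- **THE NETTING ENVELOPE**: what across-label netting can certify at the place is at most `min(Σ demand, Σ price) ≤ Σ price ≤ capSum`,
every depth. [folklore] -/
theorem min_sum_demand_sum_price_le_capSum {e m δ rin rout : ℤ} (he : 0 < e) (hio : rout ≤ rin) (L : ℕ) :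
    min (∑ k ∈ range L, demand m (1 + (k : ℤ))) (∑ k ∈ range L, price e m (1 + (k : ℤ)) δ rin rout) ≤
      ∑ k ∈ range L, priceCap e δ rin rout (1 + (k : ℤ)) :=
  (min_le_right _ _).trans (sum_le_sum fun k _ => price_le_priceCap he hio (by omega))

/-! ## §3. The verdict shape: a cap-bounded certificate over the linear total is not a door -/

/-- **NO DOOR FOR A CAP-BOUNDED CERTIFICATE.** If a profile's value at each integer dilation `n ≥ 1` is `cert(n)/(n·M₁)` with `cert(n) ≤ C̄`
(`C̄` the weighted cap total of the datum's places, `M₁ > 0` the trivial-mass slope), it is integer-price-bounded, hence not a door. [folklore] -/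
theorem intPriceBounded_of_capBound {f cert : ℝ → ℝ} {Cbar M₁ : ℝ} (hM : 0 < M₁)
    (hcert : ∀ n : ℕ, 1 ≤ n → cert n ≤ Cbar) (hf : ∀ n : ℕ, 1 ≤ n → f n = cert n / ((n : ℝ) * M₁)) :
    IntPriceBounded M₁ f := by
  refine ⟨Cbar, fun n hn => ?_⟩
  have hn0 : (0 : ℝ) < (n : ℝ) * M₁ := by
    have : (1 : ℝ) ≤ n := by exact_mod_cast hn
    positivity
  rw [hf n hn, div_mul_cancel₀ _ hn0.ne']
  exact hcert n hn

/-- Corollary: such a profile is not a door. [folklore] -/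
theorem not_doorAt_of_capBound {f cert : ℝ → ℝ} {Cbar M₁ : ℝ} (hM : 0 < M₁)
    (hcert : ∀ n : ℕ, 1 ≤ n → cert n ≤ Cbar) (hf : ∀ n : ℕ, 1 ≤ n → f n = cert n / ((n : ℝ) * M₁)) : ¬ DoorAt f :=
  not_doorAt_of_intPriceBounded hM (intPriceBounded_of_capBound hM hcert hf)

/-- **A weighted family of places**: if each place's certificate at dilation `n` is bounded by its own (m-free) cap and the weights are
non-negative, the datum certificate `Σ_w c_w·cert_w(n)` is bounded by `Σ_w c_w·cap_w`, uniformly in `n`. [folklore] -/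
theorem sum_weighted_cert_le {ι : Type*} (W : Finset ι) {c cap : ι → ℝ} {cert : ι → ℕ → ℝ}
    (hc : ∀ w ∈ W, 0 ≤ c w) (hcert : ∀ w ∈ W, ∀ n : ℕ, 1 ≤ n → cert w n ≤ cap w) (n : ℕ) (hn : 1 ≤ n) :
    ∑ w ∈ W, c w * cert w n ≤ ∑ w ∈ W, c w * cap w :=
  sum_le_sum fun w hw => mul_le_mul_of_nonneg_left (hcert w hw n hn) (hc w hw)

/-! ## §4. Junction with the BARRIER typer's file — BY NAME, no restatement
The bridge lemmas live in abc-iut-rh2-w-2's junction file `Repair/RHHeightScalingBarrierDoor.lean` (ns `…RH.HeightScalingBarrier`, staged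
HOME/abc-iut-rh2-w-2/g6/, filed by that seat once this file's parent lands): `exponentAtMost_iff_powerBoundFrom` (`ExponentAtMost f α C ↔
PowerBoundFrom f α C 1`, `Iff.rfl`) · `neverClosedFrom_of_exponentAtMost` · `not_door_and_barrier_of_table` (ONE admissibility table with
exponents `≤ a < 0` ⟹ `¬ Door Φ X` ∧ every finite admitted family `NeverClosedFrom` an explicit `barrierScale`) · `not_closedBy_of_priceBounded`
(this file's `PriceBounded` witnesses ⟹ no closing at any `s > (Σ P̄_i + tol)/M₁`) · `exists_neverClosedFrom_of_priceBounded`. This file's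
`ClosesFrom f M₁ tol s₀` is the one-member case of their `ClosedBy` read along `s ≥ s₀`. -/

/-! ## §5. Sanity row -/

/-- HEX `λ₈ @ l = 11`, `p = 7` (`e = 165`, `m₁ = 120`, `δ = 164`, `r_in = 28`, `r_out = −281`, `L = l⋆ = 5`): `2·capSum = 946·30`, i.e.
`capSum = 14190`, while `6·M_w(1) = 120·5·4·15 = 36000` (`M_w = 6000 > capSum`: the place alone never nets to zero; at dilation `n` the
ratio is `≤ 14190/(6000·n)`). [folklore] -/
theorem row_hex8_l11_capSum :
    2 * ∑ k ∈ range 5, priceCap 165 164 28 (-281) (1 + (k : ℤ)) = 946 * 30 ∧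
      6 * ∑ k ∈ range 5, demand 120 (1 + (k : ℤ)) = 120 * (5 * 4 * 15) := by
  refine ⟨?_, ?_⟩
  · rw [two_mul_capSum_eq]; norm_num
  · rw [six_mul_sum_demand_eq']; norm_num

end Summit.ABC.IUTFork.Repair.RH.HeightScaling
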